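import Mathlib.Algebra.Order.BigOperators.Group.Finset
import Mathlib.Algebra.Order.BigOperators.Ring.Finset
import Mathlib.Algebra.BigOperators.Intervals
import Mathlib.Algebra.BigOperators.Fin
import Mathlib.Data.Fin.Tuple.Basic
import Mathlib.Data.Nat.Find
import Mathlib.Algebra.BigOperators.Ring.Finset
import Mathlib.Data.Real.Basic
import Mathlib.Order.Monotone.Basic
import Mathlib.Tactic.Linarith
import Mathlib.Tactic.Positivity
import Mathlib.Tactic.FieldSimp
import Mathlib.Tactic.Ring
import HarnessLib

/-!
# Efron's monotonicity theorem (1965) for integer-valued log-concave summands (`m = 2` and general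
# `m`), and closure of PF₂ (log-concave) sequences under convolution (Keilson–Gerber 1971 / Hoggar 1974)

CITATION HEADER.  Primary: B. Efron, *Increasing properties of Pólya frequency functions*, Ann.
Math. Statist. **36** (1965) 272–279, doi:10.1214/aoms/1177700288 [Efron1965], Theorem 1 with
Remark 1 (p. 278, the integer-valued case).  Restated VERBATIM (read 2026-08-20, held
`paper:arxiv-1404.5886`) in A. Saumard, J. A. Wellner, *Log-concavity and strong log-concavity: a
review*, Statistics Surveys **8** (2014) 45–114, doi:10.1214/14-SS107 [SaumardWellner2014]:
§6.1 "**Theorem 6.1 (Efron).** Suppose that `Φ : ℝ^m → ℝ` where `Φ` is coordinatewise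
non-decreasing and let `g(z) ≡ E{Φ(X_1, ⋯, X_m) | Σ_{j=1}^m X_j = z}`, where `X_1, …, X_m` are
independent and log-concave. Then `g` is non-decreasing.  **Remark 6.2.** As noted by [Efron],
Theorem 6.1 continues to hold for integer valued random variables which are log-concave in the sense
that `p_x ≡ P(X = x)` for `x ∈ ℤ` satisfies `p_x² ≥ p_{x+1} p_{x-1}` for all `x ∈ ℤ`."; §4 "An
integer-valued random variable `X` with probability mass function `{p_x : x ∈ ℤ}` is log-concave if
`p_x² ≥ p_{x+1} p_{x-1}` for all `x ∈ ℤ` (4.1). If we define the score function `φ` by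
`φ(x) ≡ p_{x+1}/p_x`, then log-concavity of `{p_x}` is equivalent to `φ` being decreasing";
"**Theorem 4.1.** (a) ([Keilson–Gerber 1971]) The class of log-concave distributions on `ℤ` is closed
under convolution. If `U ∼ p` and `V ∼ q` are independent and `p` and `q` are log-concave, then
`U + V ∼ p ⋆ q` is log-concave."  (Saumard–Wellner derive 4.1(a) from Efron's theorem; here 4.1(a)
is proved directly, see below.)  §6.1 "**Proposition 6.3.** … Now suppose that the result holds for
`m` … by conditioning on `Σ_{j=1}^{m} X_j` … `Λ(t, u)` is non-decreasing in `t` by the induction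
hypothesis and in `u` since `Φ` is coordinatewise non-decreasing … `Σ_{j=1}^m X_j` is log-concave by
Theorem 4.1 … the case `m = 2` applies" (the induction `m = 2 ⟹ m`).

## Setting and what is proved (sequences on `ℕ`; everything is a theorem; 0 named facts)

* `IsPF2Seq p` — `p ≥ 0` on `ℕ` with non-increasing ratios in the division-free ALL-PAIRS form
  `p(x'+1) p(x) ≤ p(x+1) p(x')` (`x ≤ x'`): = (4.1) plus "no internal zeros" (the PF₂ condition;
  `IsPF2Seq.pos_of_between`: the support is an interval; `IsPF2Seq.minor`: all `2 × 2` minors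
  `p(α) p(β+k) ≤ p(α+k) p(β)`, `α ≤ β`).
* `conv p q s = Σ_{x ≤ s} p(x) q(s-x)`, `condSum p q Φ s = Σ_{x ≤ s} p(x) q(s-x) Φ(x, s-x)`.
* **`efron_step`**, **`efron_two`**, `efron_two_div`, `efron_two'` — EFRON'S THEOREM FOR `m = 2`
  SUMMANDS, discrete case: `s ↦ E[Φ(X,Y) | X + Y = s]` is non-decreasing on the support of `p ⋆ q`,
  in the division-free form `(p⋆q)(s')·Σ_{s} ≤ (p⋆q)(s)·Σ_{s'}`.  PROOF (ours, a coupling argument made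
  finite; Efron's and Saumard–Wellner's proofs are analytic): given `X+Y = s+1` the law of `X` lies,
  in the likelihood-ratio order, above the law given `X+Y = s` (log-concavity of `q`) and below its
  shift by one (log-concavity of `p`); `pre_dominance` turns this into the two prefix inequalities
  `C₁, C₀ ≥ 0`, and `band_transport` moves mass along `x ↦ {x, x+1}`, where `Φ(x, s+1-x) ≥ Φ(x, s-x)`
  and `Φ(x+1, s-x) ≥ Φ(x, s-x)`.
* **`isPF2Seq_conv`** — THEOREM 4.1(a) (Keilson–Gerber / Hoggar): `p, q` PF₂ ⇒ `p ⋆ q` PF₂.  PROOF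
  (Karlin's total-positivity argument): the Toeplitz kernel of `p ⋆ q` is the product of the TP₂
  kernels of `p` and `q` (`ker_tp2`), and a `2 × 2` minor of a product is a sum of products of
  same-sign minors (`lagrange_identity`, the Binet–Cauchy identity).  `conv_pos_of_between`.

* **`efron_many`**, `efron_many_mul` — EFRON'S THEOREM FOR `m` SUMMANDS (Saumard–Wellner Prop. 6.3),
  for the recursively defined `numR m ps Φ s = Σ_{Σ xᵢ = s} (∏ pᵢ(xᵢ)) Φ(x)` (peel off `X₀`:
  `numR_succ`) and `massR m ps = numR m ps 1` (the law of `Σ Xᵢ`; `massR_succ`: `= p₀ ⋆ massR(tail)`;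
  `isPF2Seq_massR`: PF₂ by 4.1(a)).  PROOF as printed: induction on `m`; the step is `efron_two'`
  applied to `(X₀, S')` with `Λ(u, t) = E[Φ | X₀ = u, S' = t]` read at the level `t` clamped to the
  (interval) support of `S'` — non-decreasing in `u` trivially and in `t` by the induction hypothesis.
* Bounded summands (for Joag-Dev–Proschan 1983 Thm. 2.8, `LogConcaveConditionedNA.lean`): `trunc M p`
  (restriction to `{0,…,M}`, PF₂: `isPF2Seq_trunc`), `clampFin`, the closed form over the box
  `numBox M m ps F s = Σ_{x ∈ {0..M}^m, Σ xᵢ = s} (∏ pᵢ(xᵢ)) F(x)` and the bridge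
  **`numBox_eq_numR`** (`= numR` of the truncated weights; `numBox_one_eq_massR`,
  `numBox_eq_zero_of_mass`, `numBox_nonneg`).

NOT formalised here (`-- TODO(general form)`): the continuous case (densities on `ℝ`), and strong
log-concavity refinements (Saumard–Wellner §6.2).  Nothing here is conjectural.
-/

namespace Literature.Probability.LatticeModels.EfronMonotonicity

open Finset

/-! ### PF₂ (log-concave, interval-supported) sequences -/

/-- A **PF₂ sequence** on `ℕ` (a log-concave probability mass function WITHOUT internal zeros):
`p ≥ 0` and the ratios `p(x+1)/p(x)` are non-increasing, in the division-free form
`p(x'+1) p(x) ≤ p(x+1) p(x')` for all `x ≤ x'` (for adjacent `x' = x + 1` this is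
`p_{x+1}² ≥ p_x p_{x+2}`; demanding it for all pairs excludes internal zeros).
[cite: SaumardWellner2014, §4 eq. (4.1) ("`p_x² ≥ p_{x+1} p_{x-1}` … log-concavity of `{p_x}` is equivalent to `φ` being decreasing", `φ(x) = p_{x+1}/p_x`); Efron1965, §1 (PF₂)] -/
def IsPF2Seq (p : ℕ → ℝ) : Prop :=
  (∀ x, 0 ≤ p x) ∧ ∀ x x', x ≤ x' → p (x' + 1) * p x ≤ p (x + 1) * p x'

/-- The convolution `(p ⋆ q)(s) = Σ_{x ≤ s} p(x) q(s - x)` — the law of `X + Y`, unnormalised.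
[cite: SaumardWellner2014, §4 Thm 4.1 (`U + V ∼ p ⋆ q`)] -/
def conv (p q : ℕ → ℝ) (s : ℕ) : ℝ := ∑ x ∈ range (s + 1), p x * q (s - x)

/-- `Σ_{x ≤ s} p(x) q(s-x) Φ(x, s-x)` — the unnormalised conditional expectation
`E[Φ(X, Y); X + Y = s]`. [cite: SaumardWellner2014, §6.1 Thm 6.1 (`g(z) = E{Φ(X₁,…,X_m) | Σ X_j = z}`)] -/
def condSum (p q : ℕ → ℝ) (Φ : ℕ → ℕ → ℝ) (s : ℕ) : ℝ :=
  ∑ x ∈ range (s + 1), p x * q (s - x) * Φ x (s - x)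

/-! ### A band transport lemma (the coupling behind the step `s → s + 1`) -/

section Band

/-- Strict prefix sums `Σ_{y < x} a(y)`. [folklore] -/
private def pre (a : ℕ → ℝ) (x : ℕ) : ℝ := ∑ y ∈ range x, a y

/-- `pre a (x+1) = pre a x + a x`. [folklore] -/
private theorem pre_succ (a : ℕ → ℝ) (x : ℕ) : pre a (x + 1) = pre a x + a x :=
  Finset.sum_range_succ _ _

/-- **Prefix dominance from the likelihood-ratio order.**  If `u, v ≥ 0` and `u/v` is non-decreasing
(`u(y') v(y) ≥ v(y') u(y)` for `y ≤ y'`), then the `v`-law puts relatively more mass on every initial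
segment: `U · Σ_{y<x} v ≥ V · Σ_{y<x} u` with `U = Σ_{y<K} u`, `V = Σ_{y<K} v`, `x ≤ K`. [folklore] -/
private theorem pre_dominance {u v : ℕ → ℝ}
    (hlr : ∀ y y', y ≤ y' → v y' * u y ≤ u y' * v y) {K x : ℕ} (hx : x ≤ K) :
    (∑ y ∈ range K, v y) * pre u x ≤ (∑ y ∈ range K, u y) * pre v x := by
  have splitU : ∑ y ∈ range K, u y = pre u x + ∑ y ∈ Ico x K, u y := by
    rw [pre, Finset.range_eq_Ico, Finset.range_eq_Ico]
    exact (Finset.sum_Ico_consecutive _ (Nat.zero_le x) hx).symm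
  have splitV : ∑ y ∈ range K, v y = pre v x + ∑ y ∈ Ico x K, v y := by
    rw [pre, Finset.range_eq_Ico, Finset.range_eq_Ico]
    exact (Finset.sum_Ico_consecutive _ (Nat.zero_le x) hx).symm
  rw [splitU, splitV]
  have key : (∑ y' ∈ Ico x K, v y') * pre u x ≤ (∑ y' ∈ Ico x K, u y') * pre v x := by
    rw [pre, pre, Finset.sum_mul_sum, Finset.sum_mul_sum]
    refine Finset.sum_le_sum fun y' hy' => Finset.sum_le_sum fun y hy => ?_
    exact hlr y y' ((Finset.mem_range.1 hy).le.trans (Finset.mem_Ico.1 hy').1)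
  nlinarith [key]

variable {K : ℕ} {a b G H : ℕ → ℝ}

/-- **Band transport.**  With `A = Σ a`, `B = Σ b`: if `C₁(x) = B·Σ_{y≤x} a - A·Σ_{y≤x} b ≥ 0`
(`b/B` stochastically above `a/A`) and `C₀(x) = A·Σ_{y≤x} b - B·Σ_{y<x} a ≥ 0` (`b/B` stochastically
below the shift of `a/A` by one), then mass can be moved from `a/A` to `b/B` along the band
`x ↦ {x, x+1}`, so `H(x) ≥ G(x)` and `H(x+1) ≥ G(x)` give `A · Σ b H ≥ B · Σ a G`. [folklore] -/
private theorem band_transport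
    (hC1 : ∀ x, x < K → (∑ y ∈ range K, a y) * pre b (x + 1) ≤ (∑ y ∈ range K, b y) * pre a (x + 1))
    (hC0 : ∀ x, x < K → (∑ y ∈ range K, b y) * pre a x ≤ (∑ y ∈ range K, a y) * pre b (x + 1))
    (hHG : ∀ x, G x ≤ H x) (hHG' : ∀ x, G x ≤ H (x + 1)) :
    (∑ y ∈ range K, b y) * ∑ x ∈ range K, a x * G x ≤
      (∑ y ∈ range K, a y) * ∑ x ∈ range K, b x * H x := by
  rcases Nat.eq_zero_or_pos K with hK | hK
  · subst hK; simp
  obtain ⟨k, rfl⟩ : ∃ k, K = k + 1 := ⟨K - 1, (Nat.succ_pred_eq_of_pos hK).symm⟩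
  set A := ∑ y ∈ range (k + 1), a y with hA
  set B := ∑ y ∈ range (k + 1), b y with hB
  set C₁ : ℕ → ℝ := fun x => B * pre a (x + 1) - A * pre b (x + 1) with hC₁
  set C₀ : ℕ → ℝ := fun x => A * pre b (x + 1) - B * pre a x with hC₀
  have hC1' : ∀ x, x < k + 1 → 0 ≤ C₁ x := fun x hx => by
    simp only [hC₁]; linarith [hC1 x hx]
  have hC0' : ∀ x, x < k + 1 → 0 ≤ C₀ x := fun x hx => by
    simp only [hC₀]; linarith [hC0 x hx]
  -- row and column sums of the transport plan
  have e_row : ∀ x, C₀ x + C₁ x = B * a x := fun x => by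
    simp only [hC₀, hC₁, pre_succ]; ring
  have e_col : ∀ x, C₀ (x + 1) + C₁ x = A * b (x + 1) := fun x => by
    simp only [hC₀, hC₁, pre_succ]; ring
  have e_col0 : C₀ 0 = A * b 0 := by
    simp only [hC₀, pre, Finset.sum_range_succ, Finset.sum_range_zero, zero_add]; ring
  have e_last : C₁ k = 0 := by
    simp only [hC₁, hA, hB, pre]; ring
  -- lower bound termwise
  have step1 : B * ∑ x ∈ range (k + 1), a x * G x ≤
      ∑ x ∈ range (k + 1), (C₀ x * H x + C₁ x * H (x + 1)) := by
    rw [Finset.mul_sum]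
    refine Finset.sum_le_sum fun x hx => ?_
    have hx' := Finset.mem_range.1 hx
    calc B * (a x * G x) = (C₀ x + C₁ x) * G x := by rw [e_row]; ring
      _ = C₀ x * G x + C₁ x * G x := by ring
      _ ≤ C₀ x * H x + C₁ x * H (x + 1) :=
          add_le_add (mul_le_mul_of_nonneg_left (hHG x) (hC0' x hx'))
            (mul_le_mul_of_nonneg_left (hHG' x) (hC1' x hx'))
  -- the right-hand side re-sums to `A · Σ b H`
  have step2 : ∑ x ∈ range (k + 1), (C₀ x * H x + C₁ x * H (x + 1)) =
      A * ∑ x ∈ range (k + 1), b x * H x := by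
    rw [Finset.sum_add_distrib, Finset.sum_range_succ (fun x => C₁ x * H (x + 1)), e_last,
      zero_mul, add_zero, Finset.sum_range_succ' (fun x => C₀ x * H x), Finset.mul_sum,
      Finset.sum_range_succ' (fun x => A * (b x * H x))]
    rw [add_assoc, add_comm (C₀ 0 * H 0), ← add_assoc, ← Finset.sum_add_distrib]
    congr 1
    · exact Finset.sum_congr rfl fun x _ => by rw [← add_mul, e_col]; ring
    · rw [e_col0]; ring
  exact step1.trans (le_of_eq step2)

end Band

/-! ### Efron's theorem for two summands: the step `s → s + 1` and the chain -/

/-- `q` read backwards from `t`, extended by `0`: `q̂(t, x) = q(t - x)` for `x ≤ t`, else `0`. [folklore] -/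
private def qh (q : ℕ → ℝ) (t x : ℕ) : ℝ := if x ≤ t then q (t - x) else 0

/-- Unfolding `qh` below the cut-off. [folklore] -/
private theorem qh_of_le (q : ℕ → ℝ) {t x : ℕ} (h : x ≤ t) : qh q t x = q (t - x) := if_pos h

/-- Unfolding `qh` above the cut-off. [folklore] -/
private theorem qh_of_gt (q : ℕ → ℝ) {t x : ℕ} (h : t < x) : qh q t x = 0 := if_neg (not_le.2 h)

/-- Shift invariance of `qh`. [folklore] -/
private theorem qh_succ_succ (q : ℕ → ℝ) (t x : ℕ) : qh q (t + 1) (x + 1) = qh q t x := by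
  unfold qh
  by_cases h : x ≤ t
  · rw [if_pos h, if_pos (Nat.succ_le_succ h), Nat.succ_sub_succ]
  · rw [if_neg h, if_neg (fun h' => h (Nat.succ_le_succ_iff.1 h'))]

/-- `qh ≥ 0` for `q ≥ 0`. [folklore] -/
private theorem qh_nonneg {q : ℕ → ℝ} (hq : ∀ x, 0 ≤ q x) (t x : ℕ) : 0 ≤ qh q t x := by
  unfold qh; split_ifs
  · exact hq _
  · exact le_rfl

/-- **Efron's theorem, `m = 2`, discrete, one step** (Efron 1965, Thm 1 with Remark 1 p. 278;
Saumard–Wellner Thm 6.1 / Remark 6.2): for PF₂ sequences `p, q` and `Φ` non-decreasing in each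
argument, `s ↦ E[Φ(X,Y) | X + Y = s]` is non-decreasing from `s` to `s + 1`, in the division-free form
`(p⋆q)(s+1) · Σ_{x+y=s} p q Φ ≤ (p⋆q)(s) · Σ_{x+y=s+1} p q Φ`.  Proof (ours): the conditional law of
`X` given `X + Y = s + 1` lies between that given `X + Y = s` and its shift by one in the likelihood
ratio order (log-concavity of `q`, resp. `p`), hence stochastically; transport along the band
`x ↦ {x, x+1}` and use the monotonicity of `Φ` in the second, resp. first, argument.
[cite: Efron1965, Thm. 1 and Remark 1 (integer-valued case); SaumardWellner2014, §6.1 Thm. 6.1, Remark 6.2] -/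
theorem efron_step {p q : ℕ → ℝ} (hp : IsPF2Seq p) (hq : IsPF2Seq q) {Φ : ℕ → ℕ → ℝ}
    (hΦ₁ : ∀ y, Monotone fun x => Φ x y) (hΦ₂ : ∀ x, Monotone (Φ x)) (s : ℕ) :
    conv p q (s + 1) * condSum p q Φ s ≤ conv p q s * condSum p q Φ (s + 1) := by
  -- the two (unnormalised) conditional laws of `X`
  set a : ℕ → ℝ := fun x => p x * qh q s x with ha
  set b : ℕ → ℝ := fun x => p x * qh q (s + 1) x with hb
  set G : ℕ → ℝ := fun x => Φ x (s - x) with hG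
  set H : ℕ → ℝ := fun x => Φ x (s + 1 - x) with hH
  have hp0 := hp.1
  have hq0 := hq.1
  -- identify the four sums (over `range (s+2)`)
  have eA : ∑ y ∈ range (s + 2), a y = conv p q s := by
    rw [Finset.sum_range_succ, conv]
    simp only [ha, qh_of_gt q (Nat.lt_succ_self s), mul_zero, add_zero]
    exact Finset.sum_congr rfl fun x hx =>
      by rw [qh_of_le q (Nat.lt_succ_iff.1 (Finset.mem_range.1 hx))]
  have eB : ∑ y ∈ range (s + 2), b y = conv p q (s + 1) := by
    rw [conv]
    exact Finset.sum_congr rfl fun x hx =>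
      by simp only [hb]; rw [qh_of_le q (Nat.lt_succ_iff.1 (Finset.mem_range.1 hx))]
  have eAG : ∑ x ∈ range (s + 2), a x * G x = condSum p q Φ s := by
    rw [Finset.sum_range_succ, condSum]
    simp only [ha, hG, qh_of_gt q (Nat.lt_succ_self s), mul_zero, zero_mul, add_zero]
    exact Finset.sum_congr rfl fun x hx =>
      by rw [qh_of_le q (Nat.lt_succ_iff.1 (Finset.mem_range.1 hx))]
  have eBH : ∑ x ∈ range (s + 2), b x * H x = condSum p q Φ (s + 1) := by
    rw [condSum]
    exact Finset.sum_congr rfl fun x hx => by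
      simp only [hb, hH]; rw [qh_of_le q (Nat.lt_succ_iff.1 (Finset.mem_range.1 hx))]
  rw [← eA, ← eB, ← eAG, ← eBH]
  -- likelihood ratio orders
  have lr1 : ∀ y y', y ≤ y' → a y' * b y ≤ b y' * a y := by
    intro y y' hyy
    simp only [ha, hb]
    by_cases hy' : y' ≤ s
    · have hy : y ≤ s := hyy.trans hy'
      rw [qh_of_le q hy', qh_of_le q hy, qh_of_le q (hy.trans (Nat.le_succ s)),
        qh_of_le q (hy'.trans (Nat.le_succ s)), Nat.succ_sub hy, Nat.succ_sub hy']
      have key := hq.2 (s - y') (s - y) (Nat.sub_le_sub_left hyy s)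
      have hpp : 0 ≤ p y' * p y := mul_nonneg (hp0 y') (hp0 y)
      nlinarith [key, hpp]
    · rw [qh_of_gt q (not_le.1 hy'), mul_zero, zero_mul]
      exact mul_nonneg (mul_nonneg (hp0 _) (qh_nonneg hq0 _ _))
        (mul_nonneg (hp0 _) (qh_nonneg hq0 _ _))
  -- `a⁺` = shift of `a` by one
  set ap : ℕ → ℝ := fun y => if y = 0 then 0 else a (y - 1) with hap
  have hap0 : ap 0 = 0 := by simp [hap]
  have hapS : ∀ y, ap (y + 1) = a y := fun y => by simp [hap]
  have lr2 : ∀ y y', y ≤ y' → b y' * ap y ≤ ap y' * b y := by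
    intro y y' hyy
    rcases Nat.eq_zero_or_pos y with rfl | hy
    · rw [hap0, mul_zero]
      refine mul_nonneg ?_ (mul_nonneg (hp0 _) (qh_nonneg hq0 _ _))
      simp only [hap]; split_ifs
      · exact le_rfl
      · exact mul_nonneg (hp0 _) (qh_nonneg hq0 _ _)
    · obtain ⟨z, rfl⟩ : ∃ z, y = z + 1 := ⟨y - 1, (Nat.succ_pred_eq_of_pos hy).symm⟩
      obtain ⟨z', rfl⟩ : ∃ z', y' = z' + 1 :=
        ⟨y' - 1, (Nat.succ_pred_eq_of_pos (hy.trans_le hyy)).symm⟩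
      rw [hapS, hapS]
      simp only [ha, hb, qh_succ_succ]
      have key := hp.2 z z' (Nat.succ_le_succ_iff.1 hyy)
      have hQ : 0 ≤ qh q s z' * qh q s z := mul_nonneg (qh_nonneg hq0 _ _) (qh_nonneg hq0 _ _)
      nlinarith [key, hQ]
  -- prefix dominances `C₁ ≥ 0`, `C₀ ≥ 0`
  have hC1 : ∀ x, x < s + 2 → (∑ y ∈ range (s + 2), a y) * pre b (x + 1) ≤
      (∑ y ∈ range (s + 2), b y) * pre a (x + 1) := fun x hx =>
    pre_dominance lr1 (Nat.succ_le_of_lt hx)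
  have eApS : ∑ y ∈ range (s + 3), ap y = ∑ y ∈ range (s + 2), a y := by
    rw [Finset.sum_range_succ' ap, hap0, add_zero]
    exact Finset.sum_congr rfl fun y _ => hapS y
  have eBS : ∑ y ∈ range (s + 3), b y = ∑ y ∈ range (s + 2), b y := by
    rw [Finset.sum_range_succ]
    simp only [hb, qh_of_gt q (Nat.lt_succ_self (s + 1)), mul_zero, add_zero]
  have epre : ∀ x, pre ap (x + 1) = pre a x := fun x => by
    rw [pre, pre, Finset.sum_range_succ' ap, hap0, add_zero]
    exact Finset.sum_congr rfl fun y _ => hapS y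
  have hC0 : ∀ x, x < s + 2 → (∑ y ∈ range (s + 2), b y) * pre a x ≤
      (∑ y ∈ range (s + 2), a y) * pre b (x + 1) := fun x hx => by
    have h := pre_dominance (u := ap) (v := b) lr2 (K := s + 3) (x := x + 1) (by omega)
    rwa [eApS, eBS, epre] at h
  -- monotonicity of `Φ` along the band
  have hHG : ∀ x, G x ≤ H x := fun x => hΦ₂ x (Nat.sub_le_sub_right (Nat.le_succ s) x)
  have hHG' : ∀ x, G x ≤ H (x + 1) := fun x => by
    simp only [hG, hH, Nat.succ_sub_succ]
    exact hΦ₁ (s - x) (Nat.le_succ x)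
  exact band_transport hC1 hC0 hHG hHG'

/-- PF₂ sequences have no internal zeros. [cite: SaumardWellner2014, §4 (log-concavity ⟺ `φ` decreasing); Efron1965, §1] -/
theorem IsPF2Seq.pos_of_between {p : ℕ → ℝ} (hp : IsPF2Seq p) {x y z : ℕ} (hxy : x ≤ y)
    (hyz : y ≤ z) (hx : 0 < p x) (hz : 0 < p z) : 0 < p y := by
  -- descend from `z` to `y`: if `p (w+1) > 0` and `x ≤ w` then `p w > 0`
  have down : ∀ w, x ≤ w → 0 < p (w + 1) → 0 < p w := by
    intro w hxw hw
    by_contra h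
    have hw0 : p w = 0 := le_antisymm (not_lt.1 h) (hp.1 w)
    -- ratio monotonicity between `x` and `w`: p(w+1) p(x) ≤ p(x+1) p(w) = 0
    have key := hp.2 x w hxw
    rw [hw0, mul_zero] at key
    exact absurd key (not_le.2 (mul_pos hw hx))
  obtain ⟨d, rfl⟩ := Nat.exists_eq_add_of_le hyz
  clear hyz
  induction d with
  | zero => exact hz
  | succ d ih => exact ih (down (y + d) (Nat.le_add_right_of_le hxy) hz)

/-- **Efron's theorem, `m = 2`, discrete** (Efron 1965; Saumard–Wellner Thm 6.1 + Remark 6.2): for PF₂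
sequences `p, q` and `Φ` non-decreasing in each argument,
`g(s) = E[Φ(X, Y) | X + Y = s]` is non-decreasing: for `s ≤ s'` with `(p⋆q)(t) > 0` on `[s, s')`,
`(p⋆q)(s') · Σ_{x+y=s} p q Φ ≤ (p⋆q)(s) · Σ_{x+y=s'} p q Φ`.
[cite: Efron1965, Thm. 1 and Remark 1; SaumardWellner2014, §6.1 Thm. 6.1, Remark 6.2] -/
theorem efron_two {p q : ℕ → ℝ} (hp : IsPF2Seq p) (hq : IsPF2Seq q) {Φ : ℕ → ℕ → ℝ}
    (hΦ₁ : ∀ y, Monotone fun x => Φ x y) (hΦ₂ : ∀ x, Monotone (Φ x)) {s s' : ℕ} (hss : s ≤ s')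
    (hpos : ∀ t, s ≤ t → t < s' → 0 < conv p q t) :
    conv p q s' * condSum p q Φ s ≤ conv p q s * condSum p q Φ s' := by
  obtain ⟨d, rfl⟩ := Nat.exists_eq_add_of_le hss
  induction d with
  | zero => simp
  | succ d ih =>
    have ih' := ih (Nat.le_add_right s d) fun t h1 h2 => hpos t h1 (by omega)
    have step := efron_step hp hq hΦ₁ hΦ₂ (s + d)
    have hpos' : 0 < conv p q (s + d) := hpos (s + d) (Nat.le_add_right s d) (by omega)
    have hc0 : 0 ≤ conv p q s := Finset.sum_nonneg fun x _ => mul_nonneg (hp.1 _) (hq.1 _)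
    have hc1 : 0 ≤ conv p q (s + d + 1) :=
      Finset.sum_nonneg fun x _ => mul_nonneg (hp.1 _) (hq.1 _)
    rw [← Nat.add_assoc]
    -- combine `ih'` (× conv(s+d+1)) and `step` (× conv s), cancel conv(s+d) > 0
    have h1 := mul_le_mul_of_nonneg_left ih' hc1
    have h2 := mul_le_mul_of_nonneg_left step hc0
    nlinarith [h1, h2, hpos']

/-- The normalised form: `E[Φ | S = s] ≤ E[Φ | S = s']` for `s ≤ s'` in the support of `p ⋆ q`.
[cite: Efron1965, Thm. 1 and Remark 1; SaumardWellner2014, §6.1 Thm. 6.1] -/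
theorem efron_two_div {p q : ℕ → ℝ} (hp : IsPF2Seq p) (hq : IsPF2Seq q) {Φ : ℕ → ℕ → ℝ}
    (hΦ₁ : ∀ y, Monotone fun x => Φ x y) (hΦ₂ : ∀ x, Monotone (Φ x)) {s s' : ℕ} (hss : s ≤ s')
    (hpos : ∀ t, s ≤ t → t ≤ s' → 0 < conv p q t) :
    condSum p q Φ s / conv p q s ≤ condSum p q Φ s' / conv p q s' := by
  have h := efron_two hp hq hΦ₁ hΦ₂ hss fun t h1 h2 => hpos t h1 h2.le
  rw [div_le_div_iff₀ (hpos s le_rfl hss) (hpos s' hss le_rfl)]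
  linarith


/-! ### PF₂ sequences are closed under convolution (Keilson–Gerber 1971 / Hoggar 1974) -/

section Closure

variable {p q : ℕ → ℝ}

/-- Above a zero that lies above a positive point, a PF₂ sequence vanishes. [folklore] -/
private theorem IsPF2Seq.eq_zero_above (hp : IsPF2Seq p) {x y z : ℕ} (hxy : x ≤ y) (hyz : y ≤ z)
    (hx : 0 < p x) (hy : p y = 0) : p z = 0 := by
  by_contra h
  have hz : 0 < p z := lt_of_le_of_ne (hp.1 z) (Ne.symm h)
  exact absurd hy (ne_of_gt (hp.pos_of_between hxy hyz hx hz))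

/-- General `2 × 2` minors of a PF₂ sequence: for `α ≤ β` and `k ≥ 0`,
`p(α) p(β + k) ≤ p(α + k) p(β)` (ratios over `k` steps are non-increasing too).
[cite: Efron1965, §1 (PF₂ ⟺ total positivity of order 2 of `p(x - y)`); SaumardWellner2014, §4] -/
theorem IsPF2Seq.minor (hp : IsPF2Seq p) {α β : ℕ} (hαβ : α ≤ β) (k : ℕ) :
    p α * p (β + k) ≤ p (α + k) * p β := by
  induction k with
  | zero => simp
  | succ k ih =>
    have step := hp.2 (α + k) (β + k) (by omega)
    -- step : p (β + k + 1) * p (α + k) ≤ p (α + k + 1) * p (β + k)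
    rcases (hp.1 (α + k)).lt_or_eq with hαk | hαk
    · rcases (hp.1 (β + k)).lt_or_eq with hβk | hβk
      · -- both pivots positive: multiply and cancel
        have hprod : 0 < p (α + k) * p (β + k) := mul_pos hαk hβk
        have key : p α * p (β + (k + 1)) * (p (α + k) * p (β + k)) ≤
            p (α + (k + 1)) * p β * (p (α + k) * p (β + k)) := by
          have e1 : p α * p (β + (k + 1)) * (p (α + k) * p (β + k)) =
              (p α * p (β + k)) * (p (β + k + 1) * p (α + k)) := by
            rw [show β + (k + 1) = β + k + 1 from rfl]; ring
          have e2 : p (α + (k + 1)) * p β * (p (α + k) * p (β + k)) =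
              (p (α + k) * p β) * (p (α + k + 1) * p (β + k)) := by
            rw [show α + (k + 1) = α + k + 1 from rfl]; ring
          rw [e1, e2]
          exact mul_le_mul ih step (mul_nonneg (hp.1 _) (hp.1 _)) (mul_nonneg (hp.1 _) (hp.1 _))
        exact le_of_mul_le_mul_right key hprod
      · -- p (β + k) = 0 with p (α + k) > 0 below it: everything above vanishes
        have h0 : p (β + (k + 1)) = 0 :=
          hp.eq_zero_above (by omega : α + k ≤ β + k) (by omega) hαk hβk.symm
        rw [h0, mul_zero]
        exact mul_nonneg (hp.1 _) (hp.1 _)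
    · -- p (α + k) = 0
      rcases (hp.1 α).lt_or_eq with hα | hα
      · have h0 : p (β + (k + 1)) = 0 :=
          hp.eq_zero_above (by omega : α ≤ α + k) (by omega) hα hαk.symm
        rw [h0, mul_zero]
        exact mul_nonneg (hp.1 _) (hp.1 _)
      · rw [← hα, zero_mul]
        exact mul_nonneg (hp.1 _) (hp.1 _)

/-- The Toeplitz kernel `P(i, j) = p(i - j)` (zero above the diagonal). [folklore] -/
private def ker (p : ℕ → ℝ) (i j : ℕ) : ℝ := if j ≤ i then p (i - j) else 0

/-- The kernel of a PF₂ sequence is nonnegative. [folklore] -/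
private theorem ker_nonneg (hp : IsPF2Seq p) (i j : ℕ) : 0 ≤ ker p i j := by
  unfold ker; split_ifs
  · exact hp.1 _
  · exact le_rfl

/-- Total positivity of order two of the kernel `p(i - j)` for a PF₂ sequence.
[cite: Efron1965, §1 (PF₂ = TP₂ of `p(x - y)`); SaumardWellner2014, §4] -/
private theorem ker_tp2 (hp : IsPF2Seq p) {i i' j j' : ℕ} (hi : i ≤ i') (hj : j ≤ j') :
    ker p i j' * ker p i' j ≤ ker p i j * ker p i' j' := by
  by_cases hji : j' ≤ i
  · have h1 : j ≤ i := hj.trans hji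
    have h2 : j ≤ i' := h1.trans hi
    have h3 : j' ≤ i' := hji.trans hi
    simp only [ker, if_pos hji, if_pos h1, if_pos h2, if_pos h3]
    have key := hp.minor (α := i - j') (β := i - j) (by omega) (i' - i)
    have e1 : i - j + (i' - i) = i' - j := by omega
    have e2 : i - j' + (i' - i) = i' - j' := by omega
    rw [e1, e2] at key
    exact key.trans (le_of_eq (mul_comm _ _))
  · simp only [ker, if_neg hji, zero_mul]
    exact mul_nonneg (ker_nonneg hp _ _) (ker_nonneg hp _ _)

/-- The Binet–Cauchy / Lagrange identity for `2 × 2` minors of a product of kernels. [folklore] -/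
private theorem lagrange_identity (n : ℕ) (a b c d : ℕ → ℝ) :
    ∑ j ∈ range n, ∑ j' ∈ range n, (a j * b j' - a j' * b j) * (c j * d j' - c j' * d j) =
      2 * ((∑ j ∈ range n, a j * c j) * (∑ j ∈ range n, b j * d j) -
        (∑ j ∈ range n, a j * d j) * ∑ j ∈ range n, b j * c j) := by
  have e : ∀ j j', (a j * b j' - a j' * b j) * (c j * d j' - c j' * d j) =
      a j * c j * (b j' * d j') + b j * d j * (a j' * c j') -
        (a j * d j * (b j' * c j') + b j * c j * (a j' * d j')) := fun j j' => by ring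
  simp only [e, Finset.sum_sub_distrib, Finset.sum_add_distrib, ← Finset.mul_sum, ← Finset.sum_mul]
  ring

/-- The convolution as a kernel–vector product over a large enough range. [folklore] -/
private theorem conv_eq_sum_ker (p q : ℕ → ℝ) {t T : ℕ} (hT : t + 1 ≤ T) :
    conv p q t = ∑ j ∈ range T, ker p t j * q j := by
  have h1 : ∑ j ∈ range T, ker p t j * q j = ∑ j ∈ range (t + 1), ker p t j * q j := by
    rw [← Finset.sum_range_add_sum_Ico _ hT]
    rw [Finset.sum_eq_zero (s := Ico (t + 1) T) (fun j hj => by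
      have : ¬ j ≤ t := by have := (Finset.mem_Ico.1 hj).1; omega
      simp [ker, this]), add_zero]
  rw [h1, conv, ← Finset.sum_range_reflect (fun j => ker p t j * q j) (t + 1)]
  refine Finset.sum_congr rfl fun x hx => ?_
  have hxt : x ≤ t := Nat.lt_succ_iff.1 (Finset.mem_range.1 hx)
  simp only [Nat.add_sub_cancel, ker, if_pos (Nat.sub_le t x), Nat.sub_sub_self hxt]

/-- The convolution one step down as the same kernel against the shifted vector. [folklore] -/
private theorem conv_eq_sum_ker_shift (p q : ℕ → ℝ) {t T : ℕ} (hT : t + 2 ≤ T) :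
    conv p q t = ∑ j ∈ range T, ker p (t + 1) j * (if 1 ≤ j then q (j - 1) else 0) := by
  obtain ⟨T', rfl⟩ : ∃ T', T = T' + 1 := ⟨T - 1, by omega⟩
  rw [Finset.sum_range_succ', conv_eq_sum_ker p q (show t + 1 ≤ T' by omega)]
  simp only [Nat.le_zero, one_ne_zero, if_false, mul_zero, add_zero, Nat.add_sub_cancel,
    Nat.succ_le_succ_iff, Nat.zero_le, if_true]
  refine Finset.sum_congr rfl fun j _ => ?_
  unfold ker
  by_cases h : j ≤ t
  · rw [if_pos h, if_pos (Nat.succ_le_succ h), Nat.succ_sub_succ]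
  · rw [if_neg h, if_neg (fun h' => h (Nat.succ_le_succ_iff.1 h'))]

/-- **PF₂ sequences are closed under convolution** (Keilson–Gerber 1971; Hoggar 1974; the sum of two
independent integer-valued log-concave random variables is log-concave).  Proof (Karlin's): the
kernel of `p ⋆ q` is the product of the TP₂ kernels of `p` and `q`, and `2 × 2` minors of a product
are sums of products of minors (Binet–Cauchy).
[cite: SaumardWellner2014, §4 Thm. 4.1(a) ("The class of log-concave distributions on ℤ is closed under convolution", Keilson–Gerber 1971)] -/
theorem isPF2Seq_conv (hp : IsPF2Seq p) (hq : IsPF2Seq q) : IsPF2Seq (conv p q) := by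
  refine ⟨fun s => Finset.sum_nonneg fun x _ => mul_nonneg (hp.1 _) (hq.1 _), fun s s' hss => ?_⟩
  -- write the four values as kernel–vector products over `range T`
  set T := s' + 3 with hT
  set a : ℕ → ℝ := fun j => ker p (s + 1) j
  set b : ℕ → ℝ := fun j => ker p (s' + 1) j
  set c : ℕ → ℝ := q
  set d : ℕ → ℝ := fun j => if 1 ≤ j then q (j - 1) else 0
  have e1 : conv p q (s + 1) = ∑ j ∈ range T, a j * c j := conv_eq_sum_ker p q (by omega)
  have e2 : conv p q (s' + 1) = ∑ j ∈ range T, b j * c j := conv_eq_sum_ker p q (by omega)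
  have e3 : conv p q s = ∑ j ∈ range T, a j * d j := conv_eq_sum_ker_shift p q (by omega)
  have e4 : conv p q s' = ∑ j ∈ range T, b j * d j := conv_eq_sum_ker_shift p q (by omega)
  -- every term of the Lagrange sum is a product of two same-sign minors
  have hterm : ∀ j j', 0 ≤ (a j * b j' - a j' * b j) * (c j * d j' - c j' * d j) := by
    intro j j'
    rcases le_total j j' with hjj | hjj
    · refine mul_nonneg ?_ ?_
      · have := ker_tp2 hp (show s + 1 ≤ s' + 1 by omega) hjj
        simp only [a, b]; linarith
      · -- q-minor: Q(j,0)Q(j',1) - Q(j',0)Q(j,1) with Q(j,k) = ker q j k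
        have := ker_tp2 hq hjj (Nat.zero_le 1)
        have hc : ∀ i, ker q i 0 = c i := fun i => by simp [ker, c]
        have hd : ∀ i, ker q i 1 = d i := fun i => by simp only [ker, d]
        rw [hc, hc, hd, hd] at this
        linarith
    · refine mul_nonneg_of_nonpos_of_nonpos ?_ ?_
      · have := ker_tp2 hp (show s + 1 ≤ s' + 1 by omega) hjj
        simp only [a, b]; linarith
      · have := ker_tp2 hq hjj (Nat.zero_le 1)
        have hc : ∀ i, ker q i 0 = c i := fun i => by simp [ker, c]
        have hd : ∀ i, ker q i 1 = d i := fun i => by simp only [ker, d]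
        rw [hc, hc, hd, hd] at this
        linarith
  have hsum := Finset.sum_nonneg fun j (_ : j ∈ range T) =>
    Finset.sum_nonneg fun j' (_ : j' ∈ range T) => hterm j j'
  rw [lagrange_identity] at hsum
  rw [e1, e2, e3, e4]
  linarith

end Closure


/-! ### Efron's theorem between any two points of the support -/

/-- The support of `p ⋆ q` is an interval (both factors PF₂). [cite: SaumardWellner2014, §4 Thm. 4.1(a)] -/
theorem conv_pos_of_between {p q : ℕ → ℝ} (hp : IsPF2Seq p) (hq : IsPF2Seq q) {s t s' : ℕ}
    (hst : s ≤ t) (hts : t ≤ s') (hs : 0 < conv p q s) (hs' : 0 < conv p q s') :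
    0 < conv p q t :=
  (isPF2Seq_conv hp hq).pos_of_between hst hts hs hs'

/-- **Efron's theorem, `m = 2`, discrete, endpoint form**: for PF₂ `p, q`, `Φ` non-decreasing in each
argument and `s ≤ s'` both in the support of `p ⋆ q`,
`E[Φ(X,Y) | X+Y = s] ≤ E[Φ(X,Y) | X+Y = s']`.
[cite: Efron1965, Thm. 1 and Remark 1; SaumardWellner2014, §6.1 Thm. 6.1, Remark 6.2] -/
theorem efron_two' {p q : ℕ → ℝ} (hp : IsPF2Seq p) (hq : IsPF2Seq q) {Φ : ℕ → ℕ → ℝ}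
    (hΦ₁ : ∀ y, Monotone fun x => Φ x y) (hΦ₂ : ∀ x, Monotone (Φ x)) {s s' : ℕ} (hss : s ≤ s')
    (hs : 0 < conv p q s) (hs' : 0 < conv p q s') :
    condSum p q Φ s / conv p q s ≤ condSum p q Φ s' / conv p q s' :=
  efron_two_div hp hq hΦ₁ hΦ₂ hss fun _ h1 h2 => conv_pos_of_between hp hq h1 h2 hs hs'

/-! ### Efron's theorem for `m` summands (Saumard–Wellner 2014, Prop. 6.3: induction on `m`) -/

section Many

/-- `N_m(Φ)(s) = Σ_{x₀+⋯+x_{m-1} = s} (∏ᵢ pᵢ(xᵢ)) · Φ(x)`, the unnormalised `E[Φ(X); Σᵢ Xᵢ = s]` for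
independent `Xᵢ ∼ pᵢ` on `ℕ`, DEFINED by peeling off the first summand (`x = Fin.cons x₀ x'`):
this recursion is the conditioning `E[Φ | S_{m+1} = s] = E[ E[Φ | X₀, S'] | X₀ + S' = s ]` of the
induction step of Saumard–Wellner's proof ("suppose that the result holds for `m` … condition on
`Σ_{j=1}^{m} X_j`"). [cite: SaumardWellner2014, §6.1 Thm. 6.1 and Prop. 6.3 (proof)] -/
def numR : (m : ℕ) → (Fin m → ℕ → ℝ) → ((Fin m → ℕ) → ℝ) → ℕ → ℝ
  | 0, _, Φ, s => if s = 0 then Φ (fun _ => 0) else 0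
  | m + 1, ps, Φ, s =>
      ∑ u ∈ range (s + 1),
        ps 0 u * numR m (fun i => ps i.succ) (fun x => Φ (Fin.cons u x)) (s - u)

/-- The (unnormalised) law of `S_m = X₀ + ⋯ + X_{m-1}`: `M_m(s) = N_m(1)(s)`, the `m`-fold
convolution `p₀ ⋆ ⋯ ⋆ p_{m-1}`. [cite: SaumardWellner2014, §4 Thm. 4.1 and §6.1 Prop. 6.3] -/
def massR (m : ℕ) (ps : Fin m → ℕ → ℝ) : ℕ → ℝ := numR m ps fun _ => 1

/-- Unfolding `numR` at `m = 0`. [cite: SaumardWellner2014, §6.1 Prop. 6.3 (unfolding)] -/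
theorem numR_zero (ps : Fin 0 → ℕ → ℝ) (Φ : (Fin 0 → ℕ) → ℝ) (s : ℕ) :
    numR 0 ps Φ s = if s = 0 then Φ (fun _ => 0) else 0 := rfl

/-- Unfolding `numR` at `m + 1` (condition on the first summand).
[cite: SaumardWellner2014, §6.1 Prop. 6.3 (unfolding)] -/
theorem numR_succ (m : ℕ) (ps : Fin (m + 1) → ℕ → ℝ) (Φ : (Fin (m + 1) → ℕ) → ℝ) (s : ℕ) :
    numR (m + 1) ps Φ s = ∑ u ∈ range (s + 1),
      ps 0 u * numR m (fun i => ps i.succ) (fun x => Φ (Fin.cons u x)) (s - u) := rfl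

/-- `M_{m+1} = p₀ ⋆ M_m(p₁, …, p_m)`. [cite: SaumardWellner2014, §6.1 Prop. 6.3 (unfolding)] -/
theorem massR_succ (m : ℕ) (ps : Fin (m + 1) → ℕ → ℝ) (s : ℕ) :
    massR (m + 1) ps s = conv (ps 0) (massR m fun i => ps i.succ) s := rfl

/-- `N_m` is monotone in `Φ` for nonnegative weights. [folklore] -/
private theorem numR_mono : ∀ (m : ℕ) (ps : Fin m → ℕ → ℝ) (_ : ∀ i x, 0 ≤ ps i x)
    (Φ Ψ : (Fin m → ℕ) → ℝ) (_ : ∀ x, Φ x ≤ Ψ x) (s : ℕ), numR m ps Φ s ≤ numR m ps Ψ s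
  | 0, ps, _, Φ, Ψ, h, s => by
      rw [numR_zero, numR_zero]
      split_ifs
      · exact h _
      · exact le_rfl
  | m + 1, ps, hps, Φ, Ψ, h, s => by
      rw [numR_succ, numR_succ]
      exact sum_le_sum fun u _ => mul_le_mul_of_nonneg_left
        (numR_mono m _ (fun i x => hps _ _) _ _ (fun x => h _) _) (hps 0 u)

/-- `N_m(Φ) ≥ 0` for `Φ ≥ 0` and nonnegative weights. [folklore] -/
private theorem numR_nonneg : ∀ (m : ℕ) (ps : Fin m → ℕ → ℝ) (_ : ∀ i x, 0 ≤ ps i x)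
    (Φ : (Fin m → ℕ) → ℝ) (_ : ∀ x, 0 ≤ Φ x) (s : ℕ), 0 ≤ numR m ps Φ s
  | 0, ps, _, Φ, hΦ, s => by
      rw [numR_zero]
      split_ifs
      · exact hΦ _
      · exact le_rfl
  | m + 1, ps, hps, Φ, hΦ, s => by
      rw [numR_succ]
      exact sum_nonneg fun u _ => mul_nonneg (hps 0 u)
        (numR_nonneg m _ (fun i x => hps _ _) _ (fun x => hΦ _) _)

/-- `M_m ≥ 0`. [cite: SaumardWellner2014, §6.1 Prop. 6.3 (setting)] -/
theorem massR_nonneg {m : ℕ} {ps : Fin m → ℕ → ℝ} (hps : ∀ i x, 0 ≤ ps i x) (s : ℕ) :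
    0 ≤ massR m ps s :=
  numR_nonneg m ps hps _ (fun _ => zero_le_one) s

/-- `N_m(Φ)(s) = 0` off the support of `M_m`. [folklore] -/
private theorem numR_eq_zero_of_massR : ∀ (m : ℕ) (ps : Fin m → ℕ → ℝ) (_ : ∀ i x, 0 ≤ ps i x)
    (Φ : (Fin m → ℕ) → ℝ) (s : ℕ) (_ : massR m ps s = 0), numR m ps Φ s = 0
  | 0, ps, _, Φ, s, h => by
      simp only [massR, numR_zero] at h ⊢
      split_ifs at h with hs
      · exact absurd h one_ne_zero
      · rw [if_neg hs]
  | m + 1, ps, hps, Φ, s, h => by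
      rw [massR_succ, conv] at h
      rw [numR_succ]
      have hterm := (sum_eq_zero_iff_of_nonneg fun u _ => mul_nonneg (hps 0 u)
        (massR_nonneg (fun i x => hps _ _) _)).1 h
      refine sum_eq_zero fun u hu => ?_
      rcases mul_eq_zero.1 (hterm u hu) with h0 | h0
      · rw [h0, zero_mul]
      · rw [numR_eq_zero_of_massR m _ (fun i x => hps _ _) _ _ h0, mul_zero]

/-- The law of a sum of independent PF₂ variables is PF₂ (iterated Keilson–Gerber closure).
[cite: SaumardWellner2014, §4 Thm. 4.1(a) and §6.1 Prop. 6.3 (proof, "by the induction hypothesis … log-concave")] -/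
theorem isPF2Seq_massR : ∀ (m : ℕ) (ps : Fin m → ℕ → ℝ) (_ : ∀ i, IsPF2Seq (ps i)),
    IsPF2Seq (massR m ps)
  | 0, ps, _ => by
      refine ⟨fun s => ?_, fun x x' _ => ?_⟩
      · simp only [massR, numR_zero]
        split_ifs <;> norm_num
      · simp [massR, numR_zero]
  | m + 1, ps, hps => by
      have h : massR (m + 1) ps = conv (ps 0) (massR m fun i => ps i.succ) :=
        funext (massR_succ m ps)
      rw [h]
      exact isPF2Seq_conv (hps 0) (isPF2Seq_massR m _ fun i => hps _)

/-- **Efron's monotonicity theorem, discrete, `m` summands** (Efron 1965; Saumard–Wellner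
Prop. 6.3 with Remark 6.2): for independent PF₂ (log-concave) `ℕ`-valued `X₀, …, X_{m-1}` and `Φ`
coordinatewise non-decreasing, `s ↦ E[Φ(X₀, …, X_{m-1}) | Σ Xᵢ = s]` is non-decreasing on the support
of `Σ Xᵢ`: `N_m(Φ)(s) / M_m(s) ≤ N_m(Φ)(s') / M_m(s')` for `s ≤ s'` with `M_m(s), M_m(s') > 0`.
Proof as printed: induction on `m`, conditioning on the first summand and applying the case `m = 2`
(`efron_two'`) to `(X₀, S')` with `Λ(u, t) = E[Φ | X₀ = u, S' = t]`, which is non-decreasing in `u`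
(trivially) and in `t` (induction hypothesis); `S'` is PF₂ by `isPF2Seq_massR`.
[cite: Efron1965, Thm. 1 and Remark 1 (p. 278, discrete case); SaumardWellner2014, §6.1 Thm. 6.1, Remark 6.2, Prop. 6.3] -/
theorem efron_many {m : ℕ} {ps : Fin m → ℕ → ℝ} (hps : ∀ i, IsPF2Seq (ps i))
    {Φ : (Fin m → ℕ) → ℝ} (hΦ : Monotone Φ) {s s' : ℕ} (hss : s ≤ s')
    (hs : 0 < massR m ps s) (hs' : 0 < massR m ps s') :
    numR m ps Φ s / massR m ps s ≤ numR m ps Φ s' / massR m ps s' := by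
  induction m generalizing s s' with
  | zero =>
    have h0 : s = 0 := by
      by_contra h; simp [massR, numR_zero, h] at hs
    have h0' : s' = 0 := by
      by_contra h; simp [massR, numR_zero, h] at hs'
    subst h0 h0'
    exact le_rfl
  | succ m ih =>
    classical
    -- notation: `p` the first summand, `q` the law of the sum `S'` of the others
    set p : ℕ → ℝ := ps 0 with hp_def
    set tl : Fin m → ℕ → ℝ := fun i => ps i.succ with htl_def
    have hp : IsPF2Seq p := hps 0
    have htl : ∀ i, IsPF2Seq (tl i) := fun i => hps _
    have hq : IsPF2Seq (massR m tl) := isPF2Seq_massR m tl htl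
    have hmass : ∀ t, massR (m + 1) ps t = conv p (massR m tl) t := massR_succ m ps
    rw [hmass] at hs hs'
    -- the support of `q` is nonempty (else `M_{m+1} ≡ 0`)
    have hex : ∃ t, 0 < massR m tl t := by
      by_contra h
      push Not at h
      refine hs.ne' (sum_eq_zero fun x _ => ?_)
      rw [le_antisymm (h _) (hq.1 _), mul_zero]
    -- clamp a level `t` to the support of `q` (an interval): `π t ∈ supp q`, `π` monotone, `π = id` on it
    set a : ℕ := Nat.find hex with ha_def
    have ha : 0 < massR m tl a := Nat.find_spec hex
    set π : ℕ → ℕ := fun t => max a (Nat.findGreatest (fun k => 0 < massR m tl k) t) with hπ_def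
    have hπ_mono : Monotone π := fun t t' h =>
      max_le_max le_rfl (Nat.findGreatest_mono_right (fun k => 0 < massR m tl k) h)
    have hπ_supp : ∀ t, 0 < massR m tl (π t) := by
      intro t
      by_cases h : a ≤ Nat.findGreatest (fun k => 0 < massR m tl k) t
      · rw [hπ_def]; dsimp only; rw [max_eq_right h]
        exact Nat.findGreatest_spec (P := fun k => 0 < massR m tl k)
          (h.trans (Nat.findGreatest_le t)) ha
      · rw [hπ_def]; dsimp only; rw [max_eq_left (not_le.1 h).le]
        exact ha
    have hπ_id : ∀ t, 0 < massR m tl t → π t = t := by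
      intro t ht
      rw [hπ_def]; dsimp only
      rw [Nat.findGreatest_eq ht]
      exact max_eq_right (Nat.find_min' hex ht)
    -- `Λ(u, t) = E[Φ | X₀ = u, S' = t]`, read at the clamped level
    set Λ : ℕ → ℕ → ℝ := fun u t =>
      numR m tl (fun x => Φ (Fin.cons u x)) (π t) / massR m tl (π t) with hΛ_def
    have hΛ₁ : ∀ t, Monotone fun u => Λ u t := by
      intro t u u' huu
      simp only [hΛ_def]
      exact div_le_div_of_nonneg_right (numR_mono m tl (fun i x => (htl i).1 x) _ _
        (fun x => hΦ (Fin.cons_le_cons.2 ⟨huu, le_rfl⟩)) _) (hq.1 _)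
    have hΛ₂ : ∀ u, Monotone (Λ u) := by
      intro u t t' htt
      simp only [hΛ_def]
      exact ih htl (fun x y hxy => hΦ (Fin.cons_le_cons.2 ⟨le_rfl, hxy⟩)) (hπ_mono htt)
        (hπ_supp t) (hπ_supp t')
    -- `N_{m+1}(Φ)(t) = Σ_u p(u) q(t-u) Λ(u, t-u)`
    have hnum : ∀ t, numR (m + 1) ps Φ t = condSum p (massR m tl) Λ t := by
      intro t
      rw [numR_succ, condSum]
      refine sum_congr rfl fun u _ => ?_
      rw [mul_assoc]
      congr 1
      simp only [hΛ_def]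
      rcases (hq.1 (t - u)).eq_or_lt with h0 | hpos
      · rw [← h0, zero_mul]
        exact numR_eq_zero_of_massR m tl (fun i x => (htl i).1 x) _ _ h0.symm
      · rw [hπ_id _ hpos, mul_comm, div_mul_cancel₀ _ hpos.ne']
    rw [hnum, hnum]
    exact efron_two' hp hq hΛ₁ hΛ₂ hss hs hs'

/-- Efron's theorem for `m` summands, division-free form:
`M_m(s') · N_m(Φ)(s) ≤ M_m(s) · N_m(Φ)(s')` for `s ≤ s'` in the support of `M_m`.
[cite: Efron1965, Thm. 1 and Remark 1; SaumardWellner2014, §6.1 Prop. 6.3] -/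
theorem efron_many_mul {m : ℕ} {ps : Fin m → ℕ → ℝ} (hps : ∀ i, IsPF2Seq (ps i))
    {Φ : (Fin m → ℕ) → ℝ} (hΦ : Monotone Φ) {s s' : ℕ} (hss : s ≤ s')
    (hs : 0 < massR m ps s) (hs' : 0 < massR m ps s') :
    massR m ps s' * numR m ps Φ s ≤ massR m ps s * numR m ps Φ s' := by
  have h := efron_many hps hΦ hss hs hs'
  rw [div_le_div_iff₀ hs hs'] at h
  linarith

end Many

/-! ### Bounded summands: truncation, and the closed form over a box `{0, …, M}^m` -/

section Box

/-- Truncation of a weight to `{0, …, M}` (the law of `X` conditioned on `X ≤ M`, unnormalised).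
[cite: JoagDevProschan1983, Thm. 2.8 (bounded PF₂ variables); SaumardWellner2014, §4 (restriction of a log-concave sequence to an interval)] -/
def trunc (M : ℕ) (p : ℕ → ℝ) (x : ℕ) : ℝ := if x ≤ M then p x else 0

/-- A truncated PF₂ sequence is PF₂. [cite: SaumardWellner2014, §4 Def. 4.1 (log-concave ⟹ its restriction to an interval is log-concave)] -/
theorem isPF2Seq_trunc {p : ℕ → ℝ} (hp : IsPF2Seq p) (M : ℕ) : IsPF2Seq (trunc M p) := by
  refine ⟨fun x => ?_, fun x x' hxx => ?_⟩
  · unfold trunc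
    split_ifs
    · exact hp.1 _
    · exact le_rfl
  · unfold trunc
    by_cases h : x' + 1 ≤ M
    · rw [if_pos h, if_pos (by omega), if_pos (by omega), if_pos (by omega)]
      exact hp.2 x x' hxx
    · rw [if_neg h, zero_mul]
      refine mul_nonneg ?_ ?_
      · split_ifs
        · exact hp.1 _
        · exact le_rfl
      · split_ifs
        · exact hp.1 _
        · exact le_rfl

/-- A truncated nonnegative weight is nonnegative. [cite: JoagDevProschan1983, Thm. 2.8 (bounded PF₂ variables; bookkeeping)] -/
theorem trunc_nonneg {p : ℕ → ℝ} (hp : ∀ x, 0 ≤ p x) (M x : ℕ) : 0 ≤ trunc M p x := by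
  unfold trunc
  split_ifs
  · exact hp _
  · exact le_rfl

/-- Reading a value of `ℕ` in the box `{0, …, M}` (values above `M` are sent to `M`). [folklore] -/
def clampFin (M : ℕ) (z : ℕ) : Fin (M + 1) := ⟨min z M, by omega⟩

/-- `clampFin` is the identity on the box. [folklore] -/
private theorem clampFin_coe (M : ℕ) (a : Fin (M + 1)) : clampFin M (a : ℕ) = a := by
  ext
  simp only [clampFin]
  omega

/-- `clampFin` below the cut-off. [folklore] -/
private theorem clampFin_of_le {M u : ℕ} (h : u ≤ M) : clampFin M u = ⟨u, by omega⟩ := by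
  ext
  simp only [clampFin]
  omega

/-- `clampFin` is monotone (so a coordinatewise increasing function of the box extends to a
coordinatewise increasing function of `ℕ^m`). [cite: JoagDevProschan1983, Thm. 2.8 (bounded PF₂ variables; bookkeeping)] -/
theorem clampFin_mono (M : ℕ) : Monotone (clampFin M) := fun z z' h => by
  change min z M ≤ min z' M
  exact min_le_min_right M h

/-- The closed form over the box: `Σ_{x ∈ {0,…,M}^m, Σᵢ xᵢ = s} (∏ᵢ pᵢ(xᵢ)) · F(x)`, the unnormalised
`E[F(X); Σ Xᵢ = s]` for independent `Xᵢ ∼ pᵢ|_{≤ M}`.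
[cite: SaumardWellner2014, §6.1 Thm. 6.1 (`E{Φ(X₁,…,X_m) | Σ X_j = z}`); JoagDevProschan1983, Thm. 2.8] -/
def numBox (M m : ℕ) (ps : Fin m → ℕ → ℝ) (F : (Fin m → Fin (M + 1)) → ℝ) (s : ℕ) : ℝ :=
  ∑ x : Fin m → Fin (M + 1), if ∑ i, (x i : ℕ) = s then (∏ i, ps i (x i)) * F x else 0

/-- The closed form over the box equals the recursive form for the truncated weights.
[cite: SaumardWellner2014, §6.1 Prop. 6.3 (the conditioning identity behind the induction)] -/
theorem numBox_eq_numR (M : ℕ) : ∀ (m : ℕ) (ps : Fin m → ℕ → ℝ)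
    (F : (Fin m → Fin (M + 1)) → ℝ) (s : ℕ),
    numBox M m ps F s = numR m (fun i => trunc M (ps i)) (fun z => F fun i => clampFin M (z i)) s
  | 0, ps, F, s => by
      simp only [numBox, numR_zero, Finset.univ_eq_empty, Finset.sum_empty, Finset.prod_empty,
        one_mul]
      rw [Fintype.sum_unique]
      by_cases hs : s = 0
      · subst hs
        rw [if_pos rfl, if_pos rfl]
        exact congrArg F (Subsingleton.elim _ _)
      · rw [if_neg (Ne.symm hs), if_neg hs]
  | m + 1, ps, F, s => by
      -- the induction hypothesis in each summand, with `F ∘ Fin.cons (clampFin M u)`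
      have ih : ∀ u t, numR m (fun i => trunc M (ps i.succ))
          (fun x => F fun i => clampFin M ((Fin.cons u x : Fin (m + 1) → ℕ) i)) t =
          numBox M m (fun i => ps i.succ) (fun y => F (Fin.cons (clampFin M u) y)) t := by
        intro u t
        rw [numBox_eq_numR M m]
        congr 1
        funext x
        congr 1
        funext i
        refine Fin.cases ?_ (fun j => ?_) i
        · simp only [Fin.cons_zero]
        · simp only [Fin.cons_succ]
      simp only [numR_succ, ih]
      -- split the box sum along the first coordinate
      conv_lhs => rw [numBox, ← (Fin.consEquiv fun _ => Fin (M + 1)).sum_comp,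
        Fintype.sum_prod_type]
      have hce : ∀ q : Fin (M + 1) × (Fin m → Fin (M + 1)),
          (Fin.consEquiv fun _ => Fin (M + 1)) q = Fin.cons q.1 q.2 := fun q => rfl
      simp only [hce, Fin.sum_univ_succ (n := m), Fin.prod_univ_succ (n := m), Fin.cons_zero,
        Fin.cons_succ]
      -- inner sums: `Σ_y [a + Σ y = s] p₀(a) (∏ …) F(cons a y) = p₀(a) · [a ≤ s] · numBox … (s - a)`
      have inner : ∀ a : Fin (M + 1),
          (∑ y : Fin m → Fin (M + 1), if (a : ℕ) + ∑ i, (y i : ℕ) = s then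
              ps 0 a * (∏ i, ps i.succ (y i)) * F (Fin.cons a y) else 0) =
          if (a : ℕ) ≤ s then ps 0 a *
            numBox M m (fun i => ps i.succ) (fun y => F (Fin.cons (clampFin M a) y)) (s - a)
          else 0 := by
        intro a
        rw [clampFin_coe]
        split_ifs with ha
        · rw [numBox, Finset.mul_sum]
          refine sum_congr rfl fun y _ => ?_
          have hiff : ((a : ℕ) + ∑ i, (y i : ℕ) = s) ↔ (∑ i, (y i : ℕ) = s - a) := by omega
          simp only [hiff]
          split_ifs
          · ring
          · rw [mul_zero]
        · refine sum_eq_zero fun y _ => ?_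
          rw [if_neg (by omega)]
      rw [Finset.sum_congr rfl fun a _ => inner a]
      have e := Fin.sum_univ_eq_sum_range (fun u => if u ≤ s then ps 0 u *
        numBox M m (fun i => ps i.succ) (fun y => F (Fin.cons (clampFin M u) y)) (s - u) else 0)
        (M + 1)
      beta_reduce at e
      rw [e]
      simp only [trunc, ite_mul, zero_mul]
      rw [← sum_filter, ← sum_filter]
      congr 1
      ext u
      simp only [mem_filter, mem_range]
      omega

/-- `numBox ≥ 0` for nonnegative weights and `F ≥ 0`. [cite: SaumardWellner2014, §6.1 Thm. 6.1 (setting)] -/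
theorem numBox_nonneg {M m : ℕ} {ps : Fin m → ℕ → ℝ} (hps : ∀ i x, 0 ≤ ps i x)
    {F : (Fin m → Fin (M + 1)) → ℝ} (hF : ∀ y, 0 ≤ F y) (t : ℕ) : 0 ≤ numBox M m ps F t := by
  refine sum_nonneg fun y _ => ?_
  split_ifs
  · exact mul_nonneg (Finset.prod_nonneg fun i _ => hps _ _) (hF y)
  · exact le_rfl

/-- The mass of the level `t` in the box is the recursive mass of the truncated weights.
[cite: SaumardWellner2014, §6.1 Prop. 6.3 (the conditioning identity behind the induction)] -/
theorem numBox_one_eq_massR (M m : ℕ) (ps : Fin m → ℕ → ℝ) (t : ℕ) :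
    numBox M m ps (fun _ => 1) t = massR m (fun i => trunc M (ps i)) t :=
  numBox_eq_numR M m ps (fun _ => 1) t

/-- `numBox F` vanishes at levels of zero mass (the conditional expectation given `Σ Xᵢ = t` is only
read where `P(Σ Xᵢ = t) > 0`). [cite: SaumardWellner2014, §6.1 Thm. 6.1 (setting)] -/
theorem numBox_eq_zero_of_mass {M m : ℕ} {ps : Fin m → ℕ → ℝ} (hps : ∀ i x, 0 ≤ ps i x)
    (F : (Fin m → Fin (M + 1)) → ℝ) {t : ℕ} (h : numBox M m ps (fun _ => 1) t = 0) :
    numBox M m ps F t = 0 := by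
  rw [numBox_one_eq_massR] at h
  rw [numBox_eq_numR]
  exact numR_eq_zero_of_massR m _ (fun i x => trunc_nonneg (hps i) M x) _ _ h

end Box

end Literature.Probability.LatticeModels.EfronMonotonicity
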